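import Summits.QuantumFields.YangMills.Theorems.FluctuationComparisonRegPrIntLSpreadLiftOfSmallLift
import Summits.QuantumFields.YangMills.Theorems.UnitScaleTiltFluctuationComparisonRegPrCertL3Clause
import HarnessLib

/-!
# Crux `FluctuationComparisonRegPrIntL` (stmt-QuantumFields-20520, rung R3), (A)-package road, item (B4) «SPREAD LIFT» AT EVERY ODD BLOCK SIZE `L ≥ 3` FOR A
# PRESCRIBED CUT-OFF TOP `c`: the (M3) verdict by kernel — «the organ-tangent road's lift closes for ALL `L` at any cut-off top `c > (3874825∕7077888)·√3 ≈ 0.9483`;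
# at `¾` for `L ≥ 9` today» (LEAD w3 g23 WORD №1 (iii)–(iv), pen (β′))

Cell `ym3-torus` (HUMAN RULING D-0037, YM ladder rung R3 — SU(2) YM₃ on T³: NOT d = 4, NOT infinite volume, NOT a mass gap, NOT Clay).  Width seat `ym3-torus-px12`
(gen 19; p1 lineage).  THEOREMS ONLY (0 `def`, 0 `sorry`, default heartbeats); `--supports stmt-QuantumFields-20520 --as helper`; count-neutral; NO claim on crux ∕ stub ∕
registry; `Lines/semiclassical_s2beta.lean` v11.4 untouched.

WHY.  ✓p782931 `SpreadLiftOfSmallLift` reads the STUB-1 one-step small lifts across runs (`spreadLift_window`: `OneStepSmallLift F ℰp κ δ₀`, `κ√L ≤ c` ⟹ every `θ_j`-small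
`V` has a `descend`-preimage in the `c·θ_{j+1}`-window, above the radius floor) and reaches `c = ¾` for odd `L ≥ 9` from ANSATZ T.  LEAD w3 g23's (M3) letter: from a
height, VER∘ at block size `L` needs EXACT one-step lifts with gain `κ√L ≤ c`, `c` the cut-off top of `sfCut`; the tree's landed kernels give `κ₀√L` = 0.9482 (L = 3,
`CertL3Tree`), 0.860 ∕ 0.805 (L = 5, 7, ANSATZ S), `≤ ⅔` (L ≥ 9, ANSATZ T) — so the proposed re-cut `c₂ = 24∕25` (any `c₂ > 0.9482`) would serve EVERY odd `L ≥ 3`.  THIS FILE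
types that verdict: for EVERY `c` above the floor `(3874825∕7077888)·√3` and EVERY odd `L ≥ 3`, one-step small lifts with `κ√L < c` (§3) and the spread lift into the
`c·θ_{j+1}`-window for every family, above the radius floor (§4) and FROM A HEIGHT (§4, `θ_j → 0`).  Nothing new is estimated: §1 is the fleet's face-supported
assembly ✓`exists_approxSmallLift_of_kernel` with `1 ↦ c`; §2 re-runs the three landed per-`L` clauses (CertL3Tree `kzR`, ANSATZ S `kzS`, ANSATZ T `kzT`) at the
prescribed gain; the two numerals compare `5√5∕13`, `7√7∕23`, `¾` with the floor by squaring.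

WHAT IS PROVED (namespace `Summit.QuantumFields.YangMills.Theorems.SpreadLiftAllL`).
* §1 `exists_approxSmallLift_of_kernel_gain` (face-supported assembly, gain `< c`).
* §2 `clause_three_gain` (L = 3), `clause_S_gain` (odd `L ≥ 5`, hypothesis `L·α_L·√L < c`), `clause_T_gain` (odd `L ≥ 7`, hypothesis `18∕L²·√L < c`); numerals
  `mul_sqrt_lt_mul_sqrt`, `gainS_five_lt_floor`, `gainS_seven_lt_floor`, `threeQuarters_lt_floor`.
* §3 ★★★`exists_oneStepSmallLift_gain_all (hc : 3874825∕7077888·√3 < c) (Odd L) (3 ≤ L) : ∃ κ δ₀, κ√L < c ∧ 0 < δ₀ ∧ ∀ F, F.L = L → OneStepSmallLift F ℰp κ δ₀`.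
* §4 ★★★★`spreadLift_window_all` (every family, above the radius floor) and ★★★★`spreadLift_height_all` (every family, from a height `jV` on: ✓`tendsto_θBal_atTop`).
HONEST SCOPE.  Packaging over landed theorems; (C3)∕chart∕(A)∕COAREA∘∕VER∘∕O1∕crux 20520∕`YM3TorusSU2` NOT proved; at cut-off `¾` the cases L ∈ {3, 5, 7} remain OPEN
(this file says nothing below the floor); nothing continuum ∕ OS ∕ Clay; the Yang–Mills mass gap is NOT proved.

References: T. Bałaban, CMP **109** (1987) 249–301 [Balaban1987RG1] ((0.4) p.253, (0.18) p.255); CMP **102** (1985) 255–275 [Balaban1985UV3] ((3) p.256, (7) p.257).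
-/

set_option autoImplicit false

noncomputable section

open scoped BigOperators Matrix.Norms.L2Operator
open Filter Topology

namespace Summit.QuantumFields.YangMills.Theorems.SpreadLiftAllL

open Literature.MathematicalPhysics.QuantumFieldTheory.Balaban1983to89
open Literature.MathematicalPhysics.QuantumFieldTheory.Balaban1983to89.T3ContinuumYM3Torus
open Literature.MathematicalPhysics.QuantumFieldTheory.Balaban1983to89.T3NestedUnitLaws (descend)
open Literature.MathematicalPhysics.QuantumFieldTheory.Balaban1983to89.T3UnitLawDensityEML (ℰp)
open Literature.MathematicalPhysics.QuantumFieldTheory.Balaban1983to89.T3UnitScaleTilt (θBal)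
open Literature.MathematicalPhysics.QuantumFieldTheory.Balaban1983to89.T3SmallLiftHistory (OneStepSmallLift)
open Literature.MathematicalPhysics.QuantumFieldTheory.Balaban1983to89.T3ThresholdSmallness (tendsto_θBal_atTop)
open T4Continuum BlockAveraging
open Summit.QuantumFields.YangMills.Theorems.ApproxLift
open Summit.QuantumFields.YangMills.Theorems.SpreadLiftOfSmallLift

/-! ## §1 The fleet's face-supported assembly with a prescribed gain `c` -/

/-- **FACE-SUPPORTED ASSEMBLY WITH GAIN `< c`** (= ✓`ApproxLift.exists_approxSmallLift_of_kernel` with `1 ↦ c`): a face-supported, S-neutral kernel table with row mass `K₁`,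
row bound `(λ, β)` and `λ√L < c` gives `ApproxSmallLift F κ₀ C δ₀` for every family of block size `L` with `κ₀√L < c` (radius shrunk until `(λ + (C_q+1)δ₀)√L < c`;
per step ✓`approxSmallLift_of_kernel`). [cite: Balaban1987RG1, (0.4) p.253] -/
theorem exists_approxSmallLift_of_kernel_gain (L : ℕ) (R : ℕ) (tab : (F : T3Family) → Fin 3 → (Fin 3 → Fin F.L) → Orient 3 → (Fin 3 → Fin (2 * R + 1)) → ℝ)
    {K₁ lam β Cq₀ c : ℝ} (hK0 : 0 ≤ K₁) (hlam : 0 ≤ lam) (hβ : 0 ≤ β) (hgain : lam * Real.sqrt L < c) (hCq₀ : 0 ≤ Cq₀)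
    (h : ∀ F : T3Family, F.L = L → (Cq (F.P 0) R lam β K₁ ≤ Cq₀) ∧ ∀ K, FaceSupported (P := F.P K) R (tab F) ∧
      SNeutral (P := F.P K) R (tab F) ∧ RowMass (P := F.P K) R (tab F) K₁ ∧ RowBound (P := F.P K) (Fin 2) R (tab F) lam β) :
    ∃ κ₀ C δ₀ : ℝ, 0 ≤ κ₀ ∧ κ₀ * Real.sqrt L < c ∧ 0 ≤ C ∧ 0 < δ₀ ∧ ∀ F : T3Family, F.L = L → ApproxSmallLift F κ₀ C δ₀ := by
  set sL : ℝ := Real.sqrt L with hsL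
  have hsL0 : 0 ≤ sL := Real.sqrt_nonneg _
  have hgap : 0 < c - lam * sL := by linarith
  -- the radius
  set δ₀ : ℝ := min (min (1 / 3) (1 / (320 * K₁ + 1))) ((c - lam * sL) / (2 * ((Cq₀ + 1) * sL + 1))) with hδ₀
  have hA : 0 < 320 * K₁ + 1 := by positivity
  have hB : 0 < 2 * ((Cq₀ + 1) * sL + 1) := by positivity
  have hδ₀pos : 0 < δ₀ := lt_min (lt_min (by norm_num) (by positivity)) (div_pos hgap hB)
  have hδ₀3 : δ₀ ≤ 1 / 3 := (min_le_left _ _).trans (min_le_left _ _)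
  have hδ₀K : δ₀ ≤ 1 / (320 * K₁ + 1) := (min_le_left _ _).trans (min_le_right _ _)
  have hδ₀g : δ₀ ≤ (c - lam * sL) / (2 * ((Cq₀ + 1) * sL + 1)) := min_le_right _ _
  have hKδ₀ : 16 * (K₁ * δ₀) ≤ 1 / 20 := by
    have := (le_div_iff₀ hA).mp hδ₀K
    nlinarith
  refine ⟨lam + (Cq₀ + 1) * δ₀, 452 * K₁ ^ 2, δ₀, by positivity, ?_, by positivity, hδ₀pos, fun F hFL => ?_⟩
  · have := (le_div_iff₀ hB).mp hδ₀g
    nlinarith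
  · obtain ⟨hC, hK⟩ := h F hFL
    have happ := approxSmallLift_of_kernel F (tab F) hK hK0 hlam hβ hδ₀3 hKδ₀
    intro K j hj δ hδ hδδ₀ V hV
    obtain ⟨U, hU, hacc⟩ := happ K j hj δ hδ hδδ₀ V hV
    refine ⟨U, fun p => (hU p).trans_le ?_, hacc⟩
    have : (lam + (Cq (F.P 0) R lam β K₁ + 1) * δ₀) ≤ lam + (Cq₀ + 1) * δ₀ := by nlinarith
    exact mul_le_mul_of_nonneg_right this hδ.le

/-! ## §2 The three landed per-`L` clauses at a prescribed gain, and the numerals -/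

/-- **L = 3 AT GAIN `c`** — the certified face-supported table `kzR` of `CertL3Tree` (`K₁ = 149∕288`, `λ = 3874825∕7077888`, `β = 12819∕131072`), any
`c > λ√3 ≈ 0.9482`. [cite: Balaban1987RG1, (0.4) p.253] -/
theorem clause_three_gain {c : ℝ} (hc : (3874825 / 7077888 : ℝ) * Real.sqrt ((3 : ℕ) : ℝ) < c) :
    ∃ κ₀ C δ₀ : ℝ, 0 ≤ κ₀ ∧ κ₀ * Real.sqrt ((3 : ℕ) : ℝ) < c ∧ 0 ≤ C ∧ 0 < δ₀ ∧
      ∀ F : T3Family, F.L = 3 → ApproxSmallLift F κ₀ C δ₀ := by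
  refine exists_approxSmallLift_of_kernel_gain 3 2 (fun F => CertL3Tree.kzR F) (K₁ := 149 / 288) (lam := 3874825 / 7077888) (β := 12819 / 131072)
    (Cq₀ := Cq CertL3Tree.P3 2 (3874825 / 7077888) (12819 / 131072) (149 / 288)) (by norm_num) (by norm_num) (by norm_num)
    hc (Cq_nonneg CertL3Tree.P3 2 (by norm_num) (by norm_num) (by norm_num)) fun F hFL => ?_
  obtain ⟨L, hL, m, hm⟩ := F
  simp only at hFL
  subst hFL
  exact ⟨le_of_eq rfl, fun K => ⟨CertL3Tree.faceSupported_F3 hL m hm K, CertL3Tree.sNeutral_F3 hL m hm K, CertL3Tree.rowMass_F3 hL m hm K,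
    CertL3Tree.rowBound_F3 hL m hm K⟩⟩

/-- **ODD `L ≥ 5` AT GAIN `c` FROM ANSATZ S** (`kzS`, `λ = L·α_L = L∕(5L−12)`; ✓`AnsatzS.kernel_hypotheses` needs only `5 ≤ L`), any `c > L·α_L·√L`.
[cite: Balaban1987RG1, (0.4) p.253] -/
theorem clause_S_gain {L : ℕ} (hodd : Odd L) (h5 : 5 ≤ L) {c : ℝ} (hc : (L : ℝ) * AnsatzS.alpha L * Real.sqrt L < c) :
    ∃ κ₀ C δ₀ : ℝ, 0 ≤ κ₀ ∧ κ₀ * Real.sqrt L < c ∧ 0 ≤ C ∧ 0 < δ₀ ∧ ∀ F : T3Family, F.L = L → ApproxSmallLift F κ₀ C δ₀ := by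
  have hL' : Odd L ∧ 1 < L := ⟨hodd, by omega⟩
  have hL5 : (5 : ℝ) ≤ L := by exact_mod_cast h5
  have hα := (AnsatzS.alpha_pos (by omega : 3 ≤ L)).le
  have hlam : 0 ≤ (L : ℝ) * AnsatzS.alpha L := mul_nonneg (by positivity) hα
  have hβ : 0 ≤ ((L : ℝ) - 2) * AnsatzS.alpha L := mul_nonneg (by linarith) hα
  have hK : 0 ≤ 4 * (3 : ℝ) ^ 2 * (((L : ℝ) - 2) * AnsatzS.alpha L) := mul_nonneg (by positivity) hβ
  refine exists_approxSmallLift_of_kernel_gain L 1 (fun F => AnsatzS.kzS (F.P 0)) hK hlam hβ hc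
    (Cq_nonneg (AnsatzS.P3 L 1 0 hL') 1 hlam hβ hK) fun F hFL => ⟨?_, fun K => ?_⟩
  · obtain ⟨L', hL'', m, hm⟩ := F
    cases hFL
    exact le_of_eq rfl
  · obtain ⟨L', hL'', m, hm⟩ := F
    subst hFL
    exact AnsatzS.kernel_hypotheses ⟨L', hL'', m, hm⟩ h5 K

/-- **ODD `L ≥ 7` AT GAIN `c` FROM ANSATZ T** (`kzT`, `λ = 18∕L²`, line-neutral, the interior pipeline; ✓p782931 §5 with `¾ ↦ c`), any `c > 18∕L²·√L`.
[cite: Balaban1987RG1, (0.4) p.253] -/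
theorem clause_T_gain {L : ℕ} (hodd : Odd L) (h7 : 7 ≤ L) {c : ℝ} (hc : 18 / (L : ℝ) ^ 2 * Real.sqrt L < c) :
    ∃ κ₀ C δ₀ : ℝ, 0 ≤ κ₀ ∧ κ₀ * Real.sqrt L < c ∧ 0 ≤ C ∧ 0 < δ₀ ∧ ∀ F : T3Family, F.L = L → ApproxSmallLift F κ₀ C δ₀ := by
  have hL' : Odd L ∧ 1 < L := ⟨hodd, by omega⟩
  have hlam : (0 : ℝ) ≤ 18 / (L : ℝ) ^ 2 := by positivity
  have hK : (0 : ℝ) ≤ 162 := by norm_num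
  refine exists_approxSmallLift_of_kernel_lineNeutral_gain L 1 (fun F => AnsatzT.kzT F.L) (K₁ := 162) (lam := 18 / (L : ℝ) ^ 2) (β := 1)
    (Cq₀ := Cq (AnsatzS.P3 L 1 0 hL') 1 (18 / (L : ℝ) ^ 2) 1 162) (Ca₀ := Ca (AnsatzS.P3 L 1 0 hL') 1 162)
    hK hlam zero_le_one hc (Cq_nonneg _ _ hlam zero_le_one hK) (Ca_nonneg _ _ hK) fun F hFL => ⟨?_, ?_, fun K => ?_⟩
  · obtain ⟨L', hL'', m, hm⟩ := F
    cases hFL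
    exact le_of_eq rfl
  · obtain ⟨L', hL'', m, hm⟩ := F
    cases hFL
    exact le_of_eq rfl
  · have hF3 : 3 ≤ F.L := by rw [hFL]; omega
    have hRB := AnsatzT.rowBound_T (m := F.m) (K := K) (hL := F.hL) (n := Fin 2) F.hL.1 hF3
    have hcst : (18 / (F.L : ℝ) ^ 2) = 18 / (L : ℝ) ^ 2 := by rw [hFL]
    rw [hcst] at hRB
    exact ⟨lineNeutral_of_sliceNeutral (AnsatzT.sliceNeutral_T (m := F.m) (K := K) (hL := F.hL) F.hL.1),
      AnsatzT.rowMass_T (m := F.m) (K := K) (hL := F.hL) F.hL.1 hF3, hRB⟩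

/-- `a√x < b√y` from `a²x < b²y` (`a, b, x ≥ 0`). [folklore] -/
theorem mul_sqrt_lt_mul_sqrt {a b x y : ℝ} (ha : 0 ≤ a) (hb : 0 ≤ b) (hx : 0 ≤ x) (h : a ^ 2 * x < b ^ 2 * y) :
    a * Real.sqrt x < b * Real.sqrt y := by
  have h1 : a * Real.sqrt x = Real.sqrt (a ^ 2 * x) := by
    rw [Real.sqrt_mul (sq_nonneg a), Real.sqrt_sq ha]
  have h2 : b * Real.sqrt y = Real.sqrt (b ^ 2 * y) := by
    rw [Real.sqrt_mul (sq_nonneg b), Real.sqrt_sq hb]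
  rw [h1, h2]
  exact Real.sqrt_lt_sqrt (by positivity) h

/-- ANSATZ S's gain at `L = 5` is below the floor: `5·α₅·√5 = 5√5∕13 < (3874825∕7077888)·√3` (`125∕169 < 3·3874825²∕7077888²`). [folklore] -/
theorem gainS_five_lt_floor : (5 : ℝ) * AnsatzS.alpha 5 * Real.sqrt ((5 : ℕ) : ℝ) < (3874825 / 7077888 : ℝ) * Real.sqrt ((3 : ℕ) : ℝ) := by
  have hα : (5 : ℝ) * AnsatzS.alpha 5 = 5 / 13 := by unfold AnsatzS.alpha; norm_num
  rw [hα]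
  exact mul_sqrt_lt_mul_sqrt (by norm_num) (by norm_num) (by norm_num) (by norm_num)

/-- ANSATZ S's gain at `L = 7` is below the floor: `7·α₇·√7 = 7√7∕23 < (3874825∕7077888)·√3` (`343∕529 < 3·3874825²∕7077888²`). [folklore] -/
theorem gainS_seven_lt_floor : (7 : ℝ) * AnsatzS.alpha 7 * Real.sqrt ((7 : ℕ) : ℝ) < (3874825 / 7077888 : ℝ) * Real.sqrt ((3 : ℕ) : ℝ) := by
  have hα : (7 : ℝ) * AnsatzS.alpha 7 = 7 / 23 := by unfold AnsatzS.alpha; norm_num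
  rw [hα]
  exact mul_sqrt_lt_mul_sqrt (by norm_num) (by norm_num) (by norm_num) (by norm_num)

/-- `¾` is below the floor: `¾ < (3874825∕7077888)·√3` (`9∕16 < 3·3874825²∕7077888²`). [folklore] -/
theorem threeQuarters_lt_floor : (3 / 4 : ℝ) < (3874825 / 7077888 : ℝ) * Real.sqrt ((3 : ℕ) : ℝ) := by
  have h := mul_sqrt_lt_mul_sqrt (a := 3 / 4) (b := 3874825 / 7077888) (x := 1) (y := ((3 : ℕ) : ℝ))
    (by norm_num) (by norm_num) (by norm_num) (by norm_num)
  rwa [Real.sqrt_one, mul_one] at h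

/-! ## §3 One-step small lifts with gain `κ√L < c` for EVERY odd `L ≥ 3`, any `c` above the floor -/

/-- ★★★ **ONE-STEP SMALL LIFTS AT A PRESCRIBED GAIN, ALL ODD BLOCK SIZES.**  For every `c > (3874825∕7077888)·√3 ≈ 0.9483` and every odd `L ≥ 3` there are `κ`, `δ₀ > 0`
with `κ√L < c` such that every family of block size `L` has EXACT one-step (0.4) small lifts `OneStepSmallLift F ℰp κ δ₀`: L = 3 by `CertL3Tree`, L ∈ {5, 7} by ANSATZ S
(`5√5∕13`, `7√7∕23` below the floor), L ≥ 9 by ANSATZ T (`18∕L^{3∕2} < ¾` below the floor); «exactness is free» through ✓`exists_oneStepSmallLift_of_approx_gain` at the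
midpoint between the approximate gain and `c` (so the inequality is STRICT). [cite: Balaban1987RG1, (0.4) p.253, (0.18) p.255] -/
theorem exists_oneStepSmallLift_gain_all {c : ℝ} (hc : (3874825 / 7077888 : ℝ) * Real.sqrt ((3 : ℕ) : ℝ) < c)
    {L : ℕ} (hodd : Odd L) (h3 : 3 ≤ L) :
    ∃ κ δ₀ : ℝ, κ * Real.sqrt L < c ∧ 0 < δ₀ ∧ ∀ F : T3Family, F.L = L → OneStepSmallLift F ℰp κ δ₀ := by
  -- the approximate clause at gain `< c`, by cases on `L`
  have happ : ∃ κ₀ C δ₀ : ℝ, 0 ≤ κ₀ ∧ κ₀ * Real.sqrt L < c ∧ 0 ≤ C ∧ 0 < δ₀ ∧ ∀ F : T3Family, F.L = L → ApproxSmallLift F κ₀ C δ₀ := by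
    obtain ⟨t, ht⟩ := id hodd
    by_cases h9 : 9 ≤ L
    · exact clause_T_gain hodd (by omega) ((gainT_lt_threeQuarters h9).trans (threeQuarters_lt_floor.trans hc))
    · by_cases hL3 : L = 3
      · subst hL3; exact clause_three_gain hc
      · by_cases hL5 : L = 5
        · subst hL5; exact clause_S_gain hodd (le_refl _) (gainS_five_lt_floor.trans hc)
        · have hL7 : L = 7 := by omega
          subst hL7; exact clause_S_gain hodd (by norm_num) (gainS_seven_lt_floor.trans hc)
  obtain ⟨κ₀, C, δ₀, hκ₀, hκ₀c, hC, hδ₀, hF⟩ := happ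
  -- the midpoint target makes the final gain STRICTLY below `c`
  set c' : ℝ := (κ₀ * Real.sqrt L + c) / 2 with hc'_def
  have hc'1 : κ₀ * Real.sqrt L < c' := by rw [hc'_def]; linarith
  have hc'2 : c' < c := by rw [hc'_def]; linarith
  obtain ⟨κ, δ₁, hκ, hδ₁, hF1⟩ := exists_oneStepSmallLift_of_approx_gain L (c := c') ⟨κ₀, C, δ₀, hκ₀, hc'1, hC, hδ₀, hF⟩
  exact ⟨κ, δ₁, hκ.trans_lt hc'2, hδ₁, hF1⟩

/-! ## §4 The spread lift at a prescribed cut-off top, every family: above the radius floor, and from a height -/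

/-- ★★★★ **SPREAD LIFT INTO THE `c·θ_{j+1}`-WINDOW, EVERY FAMILY, ABOVE THE RADIUS FLOOR.**  For every `c` above the floor and every `F : T3Family` there is `δ₀ > 0` such that
for every coupling window `0 < γ ≤ 1`, `0 < b₀`, `0 ≤ p₀`, every run index `j` with `θ_j ≤ δ₀` and every `V` with `PlaqSmall θ_j V`: `∃ U, descend F ℰp j U = V ∧
PlaqSmall (c·θ_{j+1}) U` (`θ_i = θBal F.L γ b₀ p₀ i`; §3 ∘ ✓`spreadLift_window`). [cite: Balaban1987RG1, (0.4) p.253, (0.18) p.255; Balaban1985UV3, (3) p.256 and (7) p.257] -/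
theorem spreadLift_window_all {c : ℝ} (hc : (3874825 / 7077888 : ℝ) * Real.sqrt ((3 : ℕ) : ℝ) < c) (F : T3Family) :
    ∃ δ₀ : ℝ, 0 < δ₀ ∧ ∀ (γ b₀ p₀ : ℝ), 0 < γ → γ ≤ 1 → 0 < b₀ → 0 ≤ p₀ →
      ∀ j : ℕ, θBal F.L γ b₀ p₀ j ≤ δ₀ →
        ∀ V : GaugeField (F.P j) 0 (Matrix.specialUnitaryGroup (Fin 2) ℂ), PlaqSmall (θBal F.L γ b₀ p₀ j) V →
          ∃ U : GaugeField (F.P (j + 1)) 0 (Matrix.specialUnitaryGroup (Fin 2) ℂ),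
            descend F ℰp j U = V ∧ PlaqSmall (c * θBal F.L γ b₀ p₀ (j + 1)) U := by
  have h3 : 3 ≤ F.L := by obtain ⟨t, ht⟩ := F.hL.1; have := F.hL.2; omega
  obtain ⟨κ, δ₀, hκ, hδ₀, hF⟩ := exists_oneStepSmallLift_gain_all hc F.hL.1 h3
  have hc0 : 0 ≤ c := le_of_lt (lt_of_le_of_lt (by positivity) hc)
  exact ⟨δ₀, hδ₀, fun γ b₀ p₀ hγ hγ1 hb hp j hj V hV => spreadLift_window F (hF F rfl) hc0 hκ.le hγ hγ1 hb hp j hj V hV⟩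

/-- ★★★★ **SPREAD LIFT INTO THE `c·θ_{j+1}`-WINDOW, EVERY FAMILY, FROM A HEIGHT.**  For every `c` above the floor, every `F : T3Family` and every coupling `0 < γ ≤ 1`,
`0 < b₀`, `0 ≤ p₀` there is a height `jV` such that for all `j ≥ jV` and every `V` with `PlaqSmall θ_j V`: `∃ U, descend F ℰp j U = V ∧ PlaqSmall (c·θ_{j+1}) U`
(the radius floor holds eventually because `θ_j → 0`, ✓`tendsto_θBal_atTop`) — the quantifier shape of VER∘'s `∃ jV, ∀ j ≥ jV`. [cite: Balaban1987RG1, (0.4) p.253; Balaban1985UV3, (7) p.257] -/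
theorem spreadLift_height_all {c : ℝ} (hc : (3874825 / 7077888 : ℝ) * Real.sqrt ((3 : ℕ) : ℝ) < c) (F : T3Family)
    {γ b₀ p₀ : ℝ} (hγ : 0 < γ) (hγ1 : γ ≤ 1) (hb : 0 < b₀) (hp : 0 ≤ p₀) :
    ∃ jV : ℕ, ∀ j : ℕ, jV ≤ j →
      ∀ V : GaugeField (F.P j) 0 (Matrix.specialUnitaryGroup (Fin 2) ℂ), PlaqSmall (θBal F.L γ b₀ p₀ j) V →
        ∃ U : GaugeField (F.P (j + 1)) 0 (Matrix.specialUnitaryGroup (Fin 2) ℂ),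
          descend F ℰp j U = V ∧ PlaqSmall (c * θBal F.L γ b₀ p₀ (j + 1)) U := by
  obtain ⟨δ₀, hδ₀, hW⟩ := spreadLift_window_all hc F
  have hev : ∀ᶠ j in atTop, θBal F.L γ b₀ p₀ j < δ₀ :=
    (tendsto_θBal_atTop F.hL.2 hγ b₀ p₀).eventually (gt_mem_nhds hδ₀)
  obtain ⟨jV, hjV⟩ := eventually_atTop.1 hev
  exact ⟨jV, fun j hj V hV => hW γ b₀ p₀ hγ hγ1 hb hp j (hjV j hj).le V hV⟩

end Summit.QuantumFields.YangMills.Theorems.SpreadLiftAllL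

end
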